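import Mathlib
import Summits.ValiantsHypothesis.ValiantsHypothesis.Theorems.KPlusLogSqLawWeakLiftingTowerGraftSignedCrossingJump

/-!
# Tower graft line — SIGNED CROSSINGS III: THE SIGNED-CROSSING LAW (transversal spectral flow of a differentiable symmetric family)

Structure file for LINE (B) `Cruxes/WeakLifting/Lines/tower_graft.lean` (crux `WeakLifting` = stmt-ValiantsHypothesis-19561),
third of the SIGNED-CROSSING series.  `H : ℝ → Matrix ι ι ℝ` real symmetric; `ν₋(u) = #{i | λ_i(H u) < 0}`,
`ν₀(u) = #{i | λ_i(H u) = 0}`, `ν₊(u) = #{i | 0 < λ_i(H u)}` (Mathlib's `(hH u).eigenvalues`, written inline; the sorted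
`eigenvalues₀` counts of `…ZoneFlux` agree by `SignedCrossing.card_filter_eigenvalues₀_eq_card_filter_eigenvalues`).

§1 local laws at a point `t` (entries continuous, resp. differentiable at `t` with entrywise derivative `H′ t`):
   `eventually_sum_abs_sub_lt` / `eventually_sum_abs_remainder_le` (the `ℓ¹` size of `H u − H t`, resp. of the Taylor remainder
   `H u − H t − (u − t)•H′ t`, is eventually small, resp. `≤ η|u − t|`); `eventually_negCount_le` / `eventually_posCount_le`
   (`ν₋`, `ν₊` are LOWER SEMICONTINUOUS); `eventually_negCount_eq_of_det_ne_zero` (`ν₋` is locally constant off the roots);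
   ★ `eventually_negCount_eq_left` / `eventually_negCount_eq_right` — THE JUMP AT A TRANSVERSAL ROOT: if `vᵀ(H′ t)v > 0` for every
   kernel vector `v ≠ 0` of `H t`, then `ν₋(u) = ν₋(t) + ν₀(t)` just left of `t` and `ν₋(u) = ν₋(t)` just right of `t`
   (all `ν₀(t)` kernel eigenvalues cross upward; vacuous transversality off the roots).
§2 THE LAW on `[a, b]` (`hd`: entrywise `HasDerivAt` at every point of `[a, b]`; `htr`: transversality at kernel vectors at every point of
   `[a, b]`, vacuous off the roots): `negCount_eq_of_forall_det_ne_zero` (constancy across a root-free `[c, d]`), `negCount_step`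
   (`ν₋(c) = ν₋(d) + ν₀(d)` when `(c, d)` is root-free), ★★ `sum_zeroCount_add_negCount_eq` — **SIGNED-CROSSING LAW**:
   for every finite `T ⊆ (a, b]` containing all roots of `det H` in `(a, b]`, `Σ_{t ∈ T} ν₀(t) + ν₋(b) = ν₋(a)` (multiplicity-exact
   spectral flow), and ★ `card_add_negCount_le` — `#T + ν₋(b) ≤ ν₋(a)` for any finite set `T` of roots in `(a, b]` (given that the
   roots in `(a, b]` are finite in number), the literal shape of `ZoneFlux.card_add_negInertia_le` with its interval-Loewner hypothesis
   replaced by transversality AT THE KERNEL VECTORS OF THE ROOTS ONLY; `card_add_negCount_le₀` — the same in `eigenvalues₀` currency.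
READING FOR THE LINE (honest): for `H = Σ_l u^{e_l}T_l` the crossing form at a root is `vᵀ(θH)(t)v/t = vᵀ((θ−c)H)(t)v/t` (any `c`) and
for a graft `G + u^D S` it is `−vᵀ((D−θ)G)(t)v/t` for ANY `S` — file IV; the residual of the zone programme is thereby cut down from
«the indefinite zone of the co-Euler base» to «the roots whose kernel vector sees the co-Euler base with the wrong sign».  Zero stub
credit; S4/S5, TowerB, WeakLifting, Conjecture B, 18050, VP ≠ VNP untouched.  Def-free; Mathlib + files I–II.
Seat: prover val-sym-lift-p2 g24, `--supports stmt-ValiantsHypothesis-19561 --as helper`.  [folklore: Kato, *Perturbation theory*,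
II.6.8 (differentiable symmetric families) / signed count of transversal eigenvalue crossings; the packaging for the line is this work]
-/

-- `Summit.ValiantsHypothesis.ValiantsHypothesis.…` repeats a component by the D-0017 layout
-- (single-conjunct summit), which the `dupNamespace` linter flags; the name is mandated.
set_option linter.dupNamespace false
set_option autoImplicit false

namespace Summit.ValiantsHypothesis.ValiantsHypothesis.Theorems.KPlusLogSqLaw.TowerGraft

open Matrix Finset Filter
open scoped BigOperators Topology
open Literature.Algebra.Polynomial.MiddleMatrixSignature (card_eigenvalues_neg_add_zero_add_pos)

namespace SignedCrossing

variable {ι : Type} [Fintype ι] [DecidableEq ι]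

/-! ## §1 Local laws at a point -/

section Local

omit [DecidableEq ι] in
/-- a finite double sum of quantities each eventually `< μ/(|ι|+1)²` is eventually `< μ`. [folklore] -/
theorem sum_sum_lt_of_forall_lt {μ : ℝ} (hμ : 0 < μ) (f : ι → ι → ℝ)
    (hf : ∀ i j, f i j < μ / ((Fintype.card ι : ℝ) + 1) ^ 2) : (∑ i, ∑ j, f i j) < μ := by
  have hc : (0 : ℝ) ≤ Fintype.card ι := Nat.cast_nonneg _
  have h1 : (∑ i, ∑ j, f i j) ≤ ∑ _i : ι, ∑ _j : ι, μ / ((Fintype.card ι : ℝ) + 1) ^ 2 :=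
    Finset.sum_le_sum fun i _ => Finset.sum_le_sum fun j _ => (hf i j).le
  rw [Finset.sum_const, Finset.sum_const, Finset.card_univ, nsmul_eq_mul, nsmul_eq_mul] at h1
  have h2 : (Fintype.card ι : ℝ) * ((Fintype.card ι : ℝ) * (μ / ((Fintype.card ι : ℝ) + 1) ^ 2)) < μ := by
    rw [show (Fintype.card ι : ℝ) * ((Fintype.card ι : ℝ) * (μ / ((Fintype.card ι : ℝ) + 1) ^ 2)) =
      μ * ((Fintype.card ι : ℝ) ^ 2 / ((Fintype.card ι : ℝ) + 1) ^ 2) by ring]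
    have h3 : (Fintype.card ι : ℝ) ^ 2 / ((Fintype.card ι : ℝ) + 1) ^ 2 < 1 := by
      rw [div_lt_one (by positivity)]
      nlinarith
    nlinarith
  exact lt_of_le_of_lt h1 h2

omit [DecidableEq ι] in
/-- entries continuous at `t` ⇒ the `ℓ¹` size of `H u − H t` is eventually below any `μ > 0`. [folklore] -/
theorem eventually_sum_abs_sub_lt (H : ℝ → Matrix ι ι ℝ) (t : ℝ) (hcont : ∀ i j, ContinuousAt (fun u => H u i j) t) {μ : ℝ} (hμ : 0 < μ) :
    ∀ᶠ u in 𝓝 t, (∑ i, ∑ j, |(H u - H t) i j|) < μ := by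
  have hμ' : 0 < μ / ((Fintype.card ι : ℝ) + 1) ^ 2 := by positivity
  have hent : ∀ i j, ∀ᶠ u in 𝓝 t, |(H u - H t) i j| < μ / ((Fintype.card ι : ℝ) + 1) ^ 2 := by
    intro i j
    have h := Metric.tendsto_nhds.mp (hcont i j) _ hμ'
    refine h.mono fun u hu => ?_
    rwa [Real.dist_eq, ← Matrix.sub_apply] at hu
  have hall : ∀ᶠ u in 𝓝 t, ∀ i j, |(H u - H t) i j| < μ / ((Fintype.card ι : ℝ) + 1) ^ 2 :=
    eventually_all.mpr fun i => eventually_all.mpr fun j => hent i j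
  exact hall.mono fun u hu => sum_sum_lt_of_forall_lt hμ _ hu

omit [DecidableEq ι] in
/-- entries differentiable at `t` with derivative `H′ t` ⇒ the `ℓ¹` size of the remainder `H u − (H t + (u − t)•H′ t)` is eventually
`≤ η |u − t|`, for every `η > 0`. [folklore] -/
theorem eventually_sum_abs_remainder_le (H : ℝ → Matrix ι ι ℝ) (t : ℝ) (H' : ℝ → Matrix ι ι ℝ) (hd : ∀ i j, HasDerivAt (fun u => H u i j) (H' t i j) t)
    {η : ℝ} (hη : 0 < η) :
    ∀ᶠ u in 𝓝 t, (∑ i, ∑ j, |(H u - (H t + (u - t) • H' t)) i j|) ≤ η * |u - t| := by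
  have hη' : 0 < η / ((Fintype.card ι : ℝ) + 1) ^ 2 := by positivity
  have hent : ∀ i j, ∀ᶠ u in 𝓝 t, |(H u - (H t + (u - t) • H' t)) i j| ≤ η / ((Fintype.card ι : ℝ) + 1) ^ 2 * |u - t| := by
    intro i j
    have h := ((hd i j).isLittleO).def hη'
    refine h.mono fun u hu => ?_
    rw [Real.norm_eq_abs, Real.norm_eq_abs, smul_eq_mul] at hu
    have he : (H u - (H t + (u - t) • H' t)) i j = H u i j - H t i j - (u - t) * H' t i j := by
      simp only [Matrix.sub_apply, Matrix.add_apply, Matrix.smul_apply, smul_eq_mul]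
      ring
    rw [he]
    exact hu
  have hall : ∀ᶠ u in 𝓝 t, ∀ i j, |(H u - (H t + (u - t) • H' t)) i j| ≤ η / ((Fintype.card ι : ℝ) + 1) ^ 2 * |u - t| :=
    eventually_all.mpr fun i => eventually_all.mpr fun j => hent i j
  refine hall.mono fun u hu => ?_
  have hc : (0 : ℝ) ≤ Fintype.card ι := Nat.cast_nonneg _
  have h1 : (∑ i, ∑ j, |(H u - (H t + (u - t) • H' t)) i j|) ≤
      ∑ _i : ι, ∑ _j : ι, η / ((Fintype.card ι : ℝ) + 1) ^ 2 * |u - t| :=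
    Finset.sum_le_sum fun i _ => Finset.sum_le_sum fun j _ => hu i j
  rw [Finset.sum_const, Finset.sum_const, Finset.card_univ, nsmul_eq_mul, nsmul_eq_mul] at h1
  refine h1.trans ?_
  rw [show (Fintype.card ι : ℝ) * ((Fintype.card ι : ℝ) * (η / ((Fintype.card ι : ℝ) + 1) ^ 2 * |u - t|)) =
    ((Fintype.card ι : ℝ) ^ 2 / ((Fintype.card ι : ℝ) + 1) ^ 2) * (η * |u - t|) by ring]
  have h3 : (Fintype.card ι : ℝ) ^ 2 / ((Fintype.card ι : ℝ) + 1) ^ 2 ≤ 1 := by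
    rw [div_le_one (by positivity)]
    nlinarith
  have h4 : 0 ≤ η * |u - t| := by positivity
  nlinarith

/-- **`ν₋` is lower semicontinuous**: entries continuous at `t` ⇒ `ν₋(t) ≤ ν₋(u)` for `u` near `t`. [folklore] -/
theorem eventually_negCount_le (H : ℝ → Matrix ι ι ℝ) (hH : ∀ u, (H u).IsHermitian) (t : ℝ) (hcont : ∀ i j, ContinuousAt (fun u => H u i j) t) :
    ∀ᶠ u in 𝓝 t, (univ.filter fun i => (hH t).eigenvalues i < 0).card ≤ (univ.filter fun i => (hH u).eigenvalues i < 0).card := by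
  obtain ⟨μ, hμ, h⟩ := exists_negCount_le_of_near (hH t)
  exact (eventually_sum_abs_sub_lt H t hcont hμ).mono fun u hu => h (H u) (hH u) hu

/-- **`ν₊` is lower semicontinuous**: entries continuous at `t` ⇒ `ν₊(t) ≤ ν₊(u)` for `u` near `t`. [folklore] -/
theorem eventually_posCount_le (H : ℝ → Matrix ι ι ℝ) (hH : ∀ u, (H u).IsHermitian) (t : ℝ) (hcont : ∀ i j, ContinuousAt (fun u => H u i j) t) :
    ∀ᶠ u in 𝓝 t, (univ.filter fun i => 0 < (hH t).eigenvalues i).card ≤ (univ.filter fun i => 0 < (hH u).eigenvalues i).card := by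
  obtain ⟨μ, hμ, h⟩ := exists_negCount_le_of_near (hH t).neg
  have hcont' : ∀ i j, ContinuousAt (fun u => (-H u) i j) t := fun i j => (hcont i j).neg
  refine (eventually_sum_abs_sub_lt (fun u => -H u) t hcont' hμ).mono fun u hu => ?_
  have h1 := h (-H u) (hH u).neg hu
  rwa [(negCount_neg_eq_posCount (hH t) (hH t).neg).1, (negCount_neg_eq_posCount (hH u) (hH u).neg).1] at h1

/-- **`ν₋` is locally constant off the roots**: entries continuous at `t` and `det H t ≠ 0` ⇒ `ν₋(u) = ν₋(t)` near `t`
(`ν₋`, `ν₊` can only grow nearby and already fill `|ι|` at `t`). [folklore] -/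
theorem eventually_negCount_eq_of_det_ne_zero (H : ℝ → Matrix ι ι ℝ) (hH : ∀ u, (H u).IsHermitian) (t : ℝ) (hcont : ∀ i j, ContinuousAt (fun u => H u i j) t) (hdet : (H t).det ≠ 0) :
    ∀ᶠ u in 𝓝 t, (univ.filter fun i => (hH u).eigenvalues i < 0).card = (univ.filter fun i => (hH t).eigenvalues i < 0).card := by
  have h0 : (univ.filter fun i => (hH t).eigenvalues i = 0).card = 0 := (zeroCount_eq_zero_iff_det_ne_zero (hH t)).mpr hdet
  have htot := card_eigenvalues_neg_add_zero_add_pos (hH t)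
  refine ((eventually_negCount_le H hH t hcont).and (eventually_posCount_le H hH t hcont)).mono fun u hu => ?_
  have htot' := card_eigenvalues_neg_add_zero_add_pos (hH u)
  omega

/-- **the jump, left side**: at a point `t` where the entries are differentiable and `vᵀ(H′ t)v > 0` for every kernel vector `v ≠ 0`
of `H t` (vacuous if `det H t ≠ 0`): `ν₋(u) = ν₋(t) + ν₀(t)` for `u < t` near `t`. [folklore: signed crossing; packaging this work] -/
theorem eventually_negCount_eq_left (H : ℝ → Matrix ι ι ℝ) (hH : ∀ u, (H u).IsHermitian) (t : ℝ) (H' : ℝ → Matrix ι ι ℝ)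
    (hd : ∀ i j, HasDerivAt (fun u => H u i j) (H' t i j) t)
    (htr : ∀ v : ι → ℝ, H t *ᵥ v = 0 → v ≠ 0 → 0 < v ⬝ᵥ H' t *ᵥ v) :
    ∀ᶠ u in 𝓝[<] t, (univ.filter fun i => (hH u).eigenvalues i < 0).card =
      (univ.filter fun i => (hH t).eigenvalues i < 0).card + (univ.filter fun i => (hH t).eigenvalues i = 0).card := by
  have hcont : ∀ i j, ContinuousAt (fun u => H u i j) t := fun i j => (hd i j).continuousAt
  obtain ⟨μ, s₀, hμ, hs₀, hjump⟩ := exists_nonposCount_le_of_near_transversal (hH t) (H' t) htr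
  have hrem := eventually_sum_abs_remainder_le H t H' hd (half_pos hμ)
  have hwin : ∀ᶠ u in 𝓝[<] t, t - s₀ < u ∧ u < t := Ioo_mem_nhdsLT (by linarith)
  have hpos := eventually_posCount_le H hH t hcont
  refine ((hrem.filter_mono nhdsWithin_le_nhds).and (hwin.and (hpos.filter_mono nhdsWithin_le_nhds))).mono
    fun u ⟨hru, ⟨hu1, hu2⟩, hpu⟩ => ?_
  -- lower bound from the transversal jump with `s = t - u`
  have hge : (univ.filter fun i => (hH t).eigenvalues i ≤ 0).card ≤ (univ.filter fun i => (hH u).eigenvalues i < 0).card := by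
    refine hjump (t - u) (by linarith) (by linarith) (H u) (hH u) ?_
    have he : H t - (t - u) • H' t = H t + (u - t) • H' t := by
      rw [sub_eq_add_neg, ← neg_smul, neg_sub]
    rw [he]
    have habs : |u - t| = t - u := by
      rw [abs_sub_comm]
      exact abs_of_pos (by linarith)
    rw [habs] at hru
    have : μ / 2 * (t - u) < μ * (t - u) := by nlinarith
    linarith
  rw [card_nonpos_eq (hH t)] at hge
  -- upper bound from lower semicontinuity of `ν₊`
  have htot := card_eigenvalues_neg_add_zero_add_pos (hH t)
  have htot' := card_eigenvalues_neg_add_zero_add_pos (hH u)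
  omega

/-- **the jump, right side**: under the same hypotheses `ν₋(u) = ν₋(t)` for `u > t` near `t` (the kernel eigenvalues have become
positive). [folklore: signed crossing; packaging this work] -/
theorem eventually_negCount_eq_right (H : ℝ → Matrix ι ι ℝ) (hH : ∀ u, (H u).IsHermitian) (t : ℝ) (H' : ℝ → Matrix ι ι ℝ)
    (hd : ∀ i j, HasDerivAt (fun u => H u i j) (H' t i j) t)
    (htr : ∀ v : ι → ℝ, H t *ᵥ v = 0 → v ≠ 0 → 0 < v ⬝ᵥ H' t *ᵥ v) :
    ∀ᶠ u in 𝓝[>] t, (univ.filter fun i => (hH u).eigenvalues i < 0).card = (univ.filter fun i => (hH t).eigenvalues i < 0).card := by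
  have hcont : ∀ i j, ContinuousAt (fun u => H u i j) t := fun i j => (hd i j).continuousAt
  have htr' : ∀ v : ι → ℝ, (-H t) *ᵥ v = 0 → v ≠ 0 → 0 < v ⬝ᵥ H' t *ᵥ v := fun v hv hv0 => by
    rw [Matrix.neg_mulVec, neg_eq_zero] at hv
    exact htr v hv hv0
  obtain ⟨μ, s₀, hμ, hs₀, hjump⟩ := exists_nonposCount_le_of_near_transversal (hH t).neg (H' t) htr'
  have hrem := eventually_sum_abs_remainder_le H t H' hd (half_pos hμ)
  have hwin : ∀ᶠ u in 𝓝[>] t, t < u ∧ u < t + s₀ := Ioo_mem_nhdsGT (by linarith)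
  have hneg := eventually_negCount_le H hH t hcont
  refine ((hrem.filter_mono nhdsWithin_le_nhds).and (hwin.and (hneg.filter_mono nhdsWithin_le_nhds))).mono
    fun u ⟨hru, ⟨hu1, hu2⟩, hnu⟩ => ?_
  -- the jump for `-H` with `s = u - t`: `#{λ(H t) ≥ 0} ≤ #{λ(H u) > 0}`
  have hge : (univ.filter fun i => 0 ≤ (hH t).eigenvalues i).card ≤ (univ.filter fun i => 0 < (hH u).eigenvalues i).card := by
    have h1 := hjump (u - t) (by linarith) (by linarith) (-H u) (hH u).neg ?_
    · rwa [(negCount_neg_eq_posCount (hH t) (hH t).neg).2, (negCount_neg_eq_posCount (hH u) (hH u).neg).1] at h1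
    · have he : -H u - (-H t - (u - t) • H' t) = -(H u - (H t + (u - t) • H' t)) := by abel
      have hsz : (∑ i, ∑ j, |(-H u - (-H t - (u - t) • H' t)) i j|) = ∑ i, ∑ j, |(H u - (H t + (u - t) • H' t)) i j| := by
        rw [he]
        exact Finset.sum_congr rfl fun i _ => Finset.sum_congr rfl fun j _ => by rw [Matrix.neg_apply, abs_neg]
      rw [hsz]
      have habs : |u - t| = u - t := abs_of_pos (by linarith)
      rw [habs] at hru
      have : μ / 2 * (u - t) < μ * (u - t) := by nlinarith
      linarith
  rw [card_nonneg_eq (hH t)] at hge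
  have htot := card_eigenvalues_neg_add_zero_add_pos (hH t)
  have htot' := card_eigenvalues_neg_add_zero_add_pos (hH u)
  omega

end Local

/-! ## §2 The law on an interval -/

section Law

/-- `ν₋` is constant across a root-free closed subinterval `[c, d] ⊆ [a, b]`. [folklore] -/
theorem negCount_eq_of_forall_det_ne_zero (H H' : ℝ → Matrix ι ι ℝ) (hH : ∀ u, (H u).IsHermitian) {a b : ℝ}
    (hd : ∀ u, a ≤ u → u ≤ b → ∀ i j, HasDerivAt (fun x => H x i j) (H' u i j) u)
    {c d : ℝ} (hac : a ≤ c) (hcd : c ≤ d) (hdb : d ≤ b)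
    (hfree : ∀ u, c ≤ u → u ≤ d → (H u).det ≠ 0) :
    (univ.filter fun i => (hH c).eigenvalues i < 0).card = (univ.filter fun i => (hH d).eigenvalues i < 0).card := by
  have hcontOn : ContinuousOn (fun u => (univ.filter fun i => (hH u).eigenvalues i < 0).card) (Set.Icc c d) := by
    intro u hu
    have hcont : ∀ i j, ContinuousAt (fun x => H x i j) u := fun i j =>
      (hd u (hac.trans hu.1) (hu.2.trans hdb) i j).continuousAt
    have hev := eventually_negCount_eq_of_det_ne_zero H hH u hcont (hfree u hu.1 hu.2)
    exact (Filter.EventuallyEq.continuousAt hev).continuousWithinAt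
  exact isPreconnected_Icc.constant hcontOn (Set.left_mem_Icc.mpr hcd) (Set.right_mem_Icc.mpr hcd)

/-- **the step**: if `(c, d)` is root-free (`a ≤ c < d ≤ b`) then `ν₋(c) = ν₋(d) + ν₀(d)`. [folklore; packaging this work] -/
theorem negCount_step (H H' : ℝ → Matrix ι ι ℝ) (hH : ∀ u, (H u).IsHermitian) {a b : ℝ}
    (hd : ∀ u, a ≤ u → u ≤ b → ∀ i j, HasDerivAt (fun x => H x i j) (H' u i j) u)
    (htr : ∀ u, a ≤ u → u ≤ b → ∀ v : ι → ℝ, H u *ᵥ v = 0 → v ≠ 0 → 0 < v ⬝ᵥ H' u *ᵥ v)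
    {c d : ℝ} (hac : a ≤ c) (hcd : c < d) (hdb : d ≤ b) (hfree : ∀ u, c < u → u < d → (H u).det ≠ 0) :
    (univ.filter fun i => (hH c).eigenvalues i < 0).card =
      (univ.filter fun i => (hH d).eigenvalues i < 0).card + (univ.filter fun i => (hH d).eigenvalues i = 0).card := by
  have hcb : c ≤ b := hcd.le.trans hdb
  have had : a ≤ d := hac.trans hcd.le
  have hR := eventually_negCount_eq_right H hH c H' (hd c hac hcb) (htr c hac hcb)
  have hL := eventually_negCount_eq_left H hH d H' (hd d had hdb) (htr d had hdb)
  obtain ⟨U, hU, hUsub⟩ := mem_nhdsGT_iff_exists_Ioo_subset.mp hR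
  obtain ⟨L, hL', hLsub⟩ := mem_nhdsLT_iff_exists_Ioo_subset.mp hL
  rw [Set.mem_Ioi] at hU; rw [Set.mem_Iio] at hL'
  -- two sample points `c < u₁ < u₂ < d` with `u₁ < U` and `L < u₂`
  set u₁ : ℝ := (c + min U d) / 2 with hu₁
  have hu₁c : c < u₁ := by
    have : c < min U d := lt_min hU hcd
    rw [hu₁]; linarith
  have hu₁U : u₁ < U := by
    have : min U d ≤ U := min_le_left _ _
    have : c < min U d := lt_min hU hcd
    rw [hu₁]; linarith
  have hu₁d : u₁ < d := by
    have : min U d ≤ d := min_le_right _ _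
    have : c < min U d := lt_min hU hcd
    rw [hu₁]; linarith
  set u₂ : ℝ := (max L u₁ + d) / 2 with hu₂
  have hu₂d : u₂ < d := by
    have : max L u₁ < d := max_lt hL' hu₁d
    rw [hu₂]; linarith
  have hLu₂ : L < u₂ := by
    have : L ≤ max L u₁ := le_max_left _ _
    have : max L u₁ < d := max_lt hL' hu₁d
    rw [hu₂]; linarith
  have hu₁u₂ : u₁ < u₂ := by
    have : u₁ ≤ max L u₁ := le_max_right _ _
    have : max L u₁ < d := max_lt hL' hu₁d
    rw [hu₂]; linarith
  have h1 : (univ.filter fun i => (hH u₁).eigenvalues i < 0).card = (univ.filter fun i => (hH c).eigenvalues i < 0).card :=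
    hUsub ⟨hu₁c, hu₁U⟩
  have h2 : (univ.filter fun i => (hH u₂).eigenvalues i < 0).card =
      (univ.filter fun i => (hH d).eigenvalues i < 0).card + (univ.filter fun i => (hH d).eigenvalues i = 0).card :=
    hLsub ⟨hLu₂, hu₂d⟩
  have h12 := negCount_eq_of_forall_det_ne_zero H H' hH hd (hac.trans hu₁c.le) hu₁u₂.le (hu₂d.le.trans hdb)
    fun u hu1 hu2 => hfree u (hu₁c.trans_le hu1) (lt_of_le_of_lt hu2 hu₂d)
  rw [← h1, h12, h2]

/-- **SIGNED-CROSSING LAW (multiplicity-exact spectral flow).**  `H` real symmetric with entries differentiable at every point of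
`[a, b]` and `vᵀ(H′ t)v > 0` for every kernel vector `v ≠ 0` of `H t` at every `t ∈ [a, b]` (vacuous off the roots of `det H`).
Then for every finite `T ⊆ (a, b]` containing all roots of `det H` in `(a, b]`:  `Σ_{t ∈ T} ν₀(t) + ν₋(b) = ν₋(a)`.
[folklore: signed count of transversal eigenvalue crossings; packaging this work] -/
theorem sum_zeroCount_add_negCount_eq (H H' : ℝ → Matrix ι ι ℝ) (hH : ∀ u, (H u).IsHermitian) {a b : ℝ}
    (hd : ∀ u, a ≤ u → u ≤ b → ∀ i j, HasDerivAt (fun x => H x i j) (H' u i j) u)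
    (htr : ∀ u, a ≤ u → u ≤ b → ∀ v : ι → ℝ, H u *ᵥ v = 0 → v ≠ 0 → 0 < v ⬝ᵥ H' u *ᵥ v)
    (hab : a ≤ b) (T : Finset ℝ) (hT : ∀ t ∈ T, a < t ∧ t ≤ b)
    (hcov : ∀ u, a < u → u ≤ b → (H u).det = 0 → u ∈ T) :
    (∑ t ∈ T, (univ.filter fun i => (hH t).eigenvalues i = 0).card) + (univ.filter fun i => (hH b).eigenvalues i < 0).card =
      (univ.filter fun i => (hH a).eigenvalues i < 0).card := by
  classical
  -- induction on `T` through its maximum, the exit point `b' ≤ b` generalized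
  suffices key : ∀ b', a ≤ b' → b' ≤ b → (∀ t ∈ T, a < t ∧ t ≤ b') → (∀ u, a < u → u ≤ b' → (H u).det = 0 → u ∈ T) →
      (∑ t ∈ T, (univ.filter fun i => (hH t).eigenvalues i = 0).card) + (univ.filter fun i => (hH b').eigenvalues i < 0).card =
        (univ.filter fun i => (hH a).eigenvalues i < 0).card from key b hab le_rfl hT hcov
  clear hT hcov
  induction T using Finset.induction_on_max with
  | empty =>
    intro b' hab' hb'b _ hcov'
    rw [Finset.sum_empty, zero_add]
    rcases hab'.eq_or_lt with rfl | hlt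
    · rfl
    · have hfree : ∀ u, a < u → u < b' → (H u).det ≠ 0 := fun u hu1 hu2 h0 =>
        (Finset.notMem_empty u) (hcov' u hu1 hu2.le h0)
      have hb'0 : (univ.filter fun i => (hH b').eigenvalues i = 0).card = 0 := by
        rw [zeroCount_eq_zero_iff_det_ne_zero]
        exact fun h0 => (Finset.notMem_empty b') (hcov' b' hlt le_rfl h0)
      have := negCount_step H H' hH hd htr le_rfl hlt hb'b hfree
      omega
  | insert t₀ S hlt ih =>
    intro b' hab' hb'b hT' hcov'
    have ht₀ := hT' t₀ (Finset.mem_insert_self _ _)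
    have ht₀S : t₀ ∉ S := fun h => lt_irrefl _ (hlt t₀ h)
    rw [Finset.sum_insert ht₀S]
    -- the exit point for `S`: `b'' = max S` (or `a` if `S = ∅`)
    obtain ⟨b'', hab'', hb''t₀, hSb'', hScov⟩ : ∃ b'', a ≤ b'' ∧ b'' < t₀ ∧ (∀ t ∈ S, a < t ∧ t ≤ b'') ∧
        (∀ u, a < u → u ≤ b'' → (H u).det = 0 → u ∈ S) := by
      rcases S.eq_empty_or_nonempty with hSe | hSne
      · refine ⟨a, le_rfl, ht₀.1, fun t ht => ?_, fun u hu1 hu2 _ => absurd hu2 (not_le.mpr hu1)⟩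
        rw [hSe] at ht
        exact absurd ht (Finset.notMem_empty t)
      · refine ⟨S.max' hSne, ?_, hlt _ (Finset.max'_mem S hSne), fun t ht => ?_, fun u hu1 hu2 h0 => ?_⟩
        · exact (hT' _ (Finset.mem_insert_of_mem (Finset.max'_mem S hSne))).1.le
        · exact ⟨(hT' t (Finset.mem_insert_of_mem ht)).1, Finset.le_max' S t ht⟩
        · have hu : u ∈ insert t₀ S :=
            hcov' u hu1 (hu2.trans ((hlt _ (Finset.max'_mem S hSne)).le.trans ht₀.2)) h0
          rcases Finset.mem_insert.mp hu with rfl | hu'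
          · exact absurd hu2 (not_le.mpr (hlt _ (Finset.max'_mem S hSne)))
          · exact hu'
    have hIH := ih b'' hab'' (hb''t₀.le.trans (ht₀.2.trans hb'b)) hSb'' hScov
    -- from `b''` to `t₀`: root-free open interval
    have hstep1 := negCount_step H H' hH hd htr hab'' hb''t₀ (ht₀.2.trans hb'b) fun u hu1 hu2 h0 => by
      have hu : u ∈ insert t₀ S := hcov' u (lt_of_le_of_lt hab'' hu1) (hu2.le.trans ht₀.2) h0
      rcases Finset.mem_insert.mp hu with rfl | hu'
      · exact lt_irrefl _ hu2
      · exact not_le.mpr hu1 (hSb'' u hu').2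
    -- from `t₀` to `b'`: root-free
    have hstep2 : (univ.filter fun i => (hH t₀).eigenvalues i < 0).card = (univ.filter fun i => (hH b').eigenvalues i < 0).card := by
      rcases ht₀.2.eq_or_lt with rfl | hlt'
      · rfl
      · have hfree : ∀ u, t₀ < u → u < b' → (H u).det ≠ 0 := fun u hu1 hu2 h0 => by
          have hu : u ∈ insert t₀ S := hcov' u (ht₀.1.trans hu1) hu2.le h0
          rcases Finset.mem_insert.mp hu with rfl | hu'
          · exact lt_irrefl _ hu1
          · exact lt_asymm hu1 (hlt u hu')
        have hb'0 : (univ.filter fun i => (hH b').eigenvalues i = 0).card = 0 := by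
          rw [zeroCount_eq_zero_iff_det_ne_zero]
          intro h0
          have hu : b' ∈ insert t₀ S := hcov' b' (ht₀.1.trans hlt') le_rfl h0
          rcases Finset.mem_insert.mp hu with h | hu'
          · rw [h] at hlt'
            exact lt_irrefl _ hlt'
          · exact lt_asymm hlt' (hlt b' hu')
        have := negCount_step H H' hH hd htr ht₀.1.le hlt' hb'b hfree
        omega
    omega

/-- **SIGNED-CROSSING LAW, counting form**: if the roots of `det H` in `(a, b]` are finite in number, then for every finite set `T`
of roots in `(a, b]`, `#T + ν₋(b) ≤ ν₋(a)` — the shape of `ZoneFlux.card_add_negInertia_le` with positive definite increments on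
`[a, b]` replaced by transversality at the kernel vectors of the roots. [this work] -/
theorem card_add_negCount_le (H H' : ℝ → Matrix ι ι ℝ) (hH : ∀ u, (H u).IsHermitian) {a b : ℝ}
    (hd : ∀ u, a ≤ u → u ≤ b → ∀ i j, HasDerivAt (fun x => H x i j) (H' u i j) u)
    (htr : ∀ u, a ≤ u → u ≤ b → ∀ v : ι → ℝ, H u *ᵥ v = 0 → v ≠ 0 → 0 < v ⬝ᵥ H' u *ᵥ v)
    (hab : a ≤ b) (hfin : {u : ℝ | a < u ∧ u ≤ b ∧ (H u).det = 0}.Finite)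
    (T : Finset ℝ) (hT : ∀ t ∈ T, a < t ∧ t ≤ b ∧ (H t).det = 0) :
    T.card + (univ.filter fun i => (hH b).eigenvalues i < 0).card ≤ (univ.filter fun i => (hH a).eigenvalues i < 0).card := by
  classical
  set T' := hfin.toFinset with hT'
  have hT'mem : ∀ t ∈ T', a < t ∧ t ≤ b := fun t ht => by
    have h := (Set.Finite.mem_toFinset hfin).mp ht
    exact ⟨h.1, h.2.1⟩
  have hcov : ∀ u, a < u → u ≤ b → (H u).det = 0 → u ∈ T' := fun u hu1 hu2 h0 =>
    (Set.Finite.mem_toFinset hfin).mpr ⟨hu1, hu2, h0⟩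
  have hlaw := sum_zeroCount_add_negCount_eq H H' hH hd htr hab T' hT'mem hcov
  have hsub : T ⊆ T' := fun t ht => (Set.Finite.mem_toFinset hfin).mpr (hT t ht)
  have h1 : T.card ≤ ∑ t ∈ T, (univ.filter fun i => (hH t).eigenvalues i = 0).card := by
    rw [Finset.card_eq_sum_ones]
    refine Finset.sum_le_sum fun t ht => ?_
    have hne : (univ.filter fun i => (hH t).eigenvalues i = 0).card ≠ 0 := fun h0 =>
      ((zeroCount_eq_zero_iff_det_ne_zero (hH t)).mp h0) (hT t ht).2.2
    omega
  have h2 : (∑ t ∈ T, (univ.filter fun i => (hH t).eigenvalues i = 0).card) ≤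
      ∑ t ∈ T', (univ.filter fun i => (hH t).eigenvalues i = 0).card :=
    Finset.sum_le_sum_of_subset_of_nonneg hsub fun _ _ _ => Nat.zero_le _
  omega

/-- the counting form in the sorted-eigenvalue currency `ν₋(A) = #{k | λ↓ₖ(A) < 0}` of `…ZoneFlux`. [this work] -/
theorem card_add_negCount_le₀ (H H' : ℝ → Matrix ι ι ℝ) (hH : ∀ u, (H u).IsHermitian) {a b : ℝ}
    (hd : ∀ u, a ≤ u → u ≤ b → ∀ i j, HasDerivAt (fun x => H x i j) (H' u i j) u)
    (htr : ∀ u, a ≤ u → u ≤ b → ∀ v : ι → ℝ, H u *ᵥ v = 0 → v ≠ 0 → 0 < v ⬝ᵥ H' u *ᵥ v)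
    (hab : a ≤ b) (hfin : {u : ℝ | a < u ∧ u ≤ b ∧ (H u).det = 0}.Finite)
    (T : Finset ℝ) (hT : ∀ t ∈ T, a < t ∧ t ≤ b ∧ (H t).det = 0) :
    T.card + (univ.filter fun k => (hH b).eigenvalues₀ k < 0).card ≤ (univ.filter fun k => (hH a).eigenvalues₀ k < 0).card := by
  rw [card_filter_eigenvalues₀_eq_card_filter_eigenvalues (hH b) (fun x => x < 0),
    card_filter_eigenvalues₀_eq_card_filter_eigenvalues (hH a) (fun x => x < 0)]
  exact card_add_negCount_le H H' hH hd htr hab hfin T hT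

end Law

end SignedCrossing

end Summit.ValiantsHypothesis.ValiantsHypothesis.Theorems.KPlusLogSqLaw.TowerGraft
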